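import Summits.ValiantsHypothesis.ValiantsHypothesis.Theorems.KPlusLogSqLawStaticPathSweepChain

/-!
# Route «KPlusLogSqLaw» — parametric max-weight independent set on a path: a chain of optima realising EVERY event crossing

HONEST FRAMING.  Helper toward the crux `WeakLifting` (item `stmt-ValiantsHypothesis-19561`, route `KPlusLogSqLaw`, cell `pub-symmetroid`,
seat val-sym-lift-p4 g8, 2026-08-27) on the line of its witness-plan stub `stub_tridiagonalSectorB` (tropical twin of the STATIC tridiagonal
sector = parametric maximum-weight independent set on a path = Eppstein's parametric closure problem on the fence, arXiv:1504.04073).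
Capstone of the sweep files: in general position (pairwise distinct crossing abscissae of non-parallel prefix-sum pairs, parallel pairs distinct
lines, no crossing exactly at the two ends `θlo < θhi`), there is a chain of optimal sets at strictly increasing parameters inside `(θlo, θhi)`, with
pairwise distinct prefix-sum values at every sample and consecutive sets distinct, whose number of steps EQUALS the number of event crossings in
`(θlo, θhi)` (`exists_chain_card_eventCrossings`).  With `chain_le_card_eventCrossings` (no chain is longer): the maximal chain length on a generic
window IS the dual event count of LINEAR-LAW §2 — so an exact evaluation of the event test at the `C(n+1,2)` crossings of an explicit instance
certifies its tropical count in the kernel from below and from above.  Construction: sort the event abscissae (`Finset.orderEmbOfFin`), sample just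
after each one and just before the first (midpoints to the neighbouring cuts), use `ne_across_eventCrossing` across each event and
`eq_of_no_eventCrossing` in between.  Statements about a path DP; nothing here asserts anything about `WeakLifting`, `TropicalB`, `KPlusLogSqLaw`,
the stub in its window, `MatrixDescartes` (stmt-ValiantsHypothesis-18050) or `VP ≠ VNP`.
-/

set_option linter.dupNamespace false
set_option autoImplicit false

namespace Summit.ValiantsHypothesis.ValiantsHypothesis.Theorems.KPlusLogSqLaw

open Finset Classical

namespace StaticPathFold

noncomputable section

variable (w₁ w₀ : ℕ → ℝ)

/-- **A CHAIN REALISING EVERY EVENT CROSSING.** [folklore] -/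
theorem exists_chain_card_eventCrossings {i n : ℕ} {θlo θhi : ℝ} (hlohi : θlo < θhi)
    (hgen : ∀ p q p' q', p < q → q ≤ n → p' < q' → q' ≤ n → (p ≠ p' ∨ q ≠ q') →
      altA (shift i w₁) p ≠ altA (shift i w₁) q → altA (shift i w₁) p' ≠ altA (shift i w₁) q' →
      (altB (shift i w₀) q - altB (shift i w₀) p) / (altA (shift i w₁) p - altA (shift i w₁) q) ≠
        (altB (shift i w₀) q' - altB (shift i w₀) p') / (altA (shift i w₁) p' - altA (shift i w₁) q'))
    (hpar : ∀ p q, p < q → q ≤ n → altA (shift i w₁) p = altA (shift i w₁) q → altB (shift i w₀) p ≠ altB (shift i w₀) q)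
    (hends : ∀ p q, p < q → q ≤ n → altA (shift i w₁) p ≠ altA (shift i w₁) q →
      (altB (shift i w₀) q - altB (shift i w₀) p) / (altA (shift i w₁) p - altA (shift i w₁) q) ≠ θlo ∧
      (altB (shift i w₀) q - altB (shift i w₀) p) / (altA (shift i w₁) p - altA (shift i w₁) q) ≠ θhi) :
    ∃ (N : ℕ) (θs : Fin (N + 1) → ℝ) (Ms : Fin (N + 1) → Finset ℕ),
      N = (((range (n + 1)) ×ˢ (range (n + 1))).filter (fun pq : ℕ × ℕ => pq.1 < pq.2 ∧
          altA (shift i w₁) pq.1 ≠ altA (shift i w₁) pq.2 ∧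
          θlo < (altB (shift i w₀) pq.2 - altB (shift i w₀) pq.1) / (altA (shift i w₁) pq.1 - altA (shift i w₁) pq.2) ∧
          (altB (shift i w₀) pq.2 - altB (shift i w₀) pq.1) / (altA (shift i w₁) pq.1 - altA (shift i w₁) pq.2) < θhi ∧
          lab (altA (shift i w₁)) (altB (shift i w₀)) (pq.2 - 1)
              ((altB (shift i w₀) pq.2 - altB (shift i w₀) pq.1) / (altA (shift i w₁) pq.1 - altA (shift i w₁) pq.2)) = pq.1 ∧
          fold (altA (shift 0 (rev i n w₁))) (altB (shift 0 (rev i n w₀))) (n - pq.2)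
              ((altB (shift i w₀) pq.2 - altB (shift i w₀) pq.1) / (altA (shift i w₁) pq.1 - altA (shift i w₁) pq.2)) =
            L (altA (shift 0 (rev i n w₁))) (altB (shift 0 (rev i n w₀))) (n - pq.2)
              ((altB (shift i w₀) pq.2 - altB (shift i w₀) pq.1) / (altA (shift i w₁) pq.1 - altA (shift i w₁) pq.2)))).card ∧
      StrictMono θs ∧ (∀ k, θlo < θs k ∧ θs k < θhi) ∧ (∀ k, Ms k ∈ indepSets i n) ∧
      (∀ k, ∑ t ∈ Ms k, W w₁ w₀ t (θs k) = opt w₁ w₀ i n (θs k)) ∧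
      (∀ k, ∀ p q, p ≤ n → q ≤ n → p ≠ q →
        L (altA (shift i w₁)) (altB (shift i w₀)) p (θs k) ≠ L (altA (shift i w₁)) (altB (shift i w₀)) q (θs k)) ∧
      (∀ e : Fin N, Ms e.castSucc ≠ Ms e.succ) := by
  set A := altA (shift i w₁) with hAdef
  set B := altB (shift i w₀) with hBdef
  set τ : ℕ × ℕ → ℝ := fun pq => (B pq.2 - B pq.1) / (A pq.1 - A pq.2) with hτ
  set P : Finset (ℕ × ℕ) := ((range (n + 1)) ×ˢ (range (n + 1))).filter (fun pq : ℕ × ℕ => pq.1 < pq.2 ∧ A pq.1 ≠ A pq.2 ∧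
    θlo < τ pq ∧ τ pq < θhi) with hP
  set EV := ((range (n + 1)) ×ˢ (range (n + 1))).filter (fun pq : ℕ × ℕ => pq.1 < pq.2 ∧ A pq.1 ≠ A pq.2 ∧
    θlo < τ pq ∧ τ pq < θhi ∧ (lab A B (pq.2 - 1) (τ pq) = pq.1 ∧
      fold (altA (shift 0 (rev i n w₁))) (altB (shift 0 (rev i n w₀))) (n - pq.2) (τ pq) =
        L (altA (shift 0 (rev i n w₁))) (altB (shift 0 (rev i n w₀))) (n - pq.2) (τ pq))) with hEV
  have hmemP : ∀ pq : ℕ × ℕ, pq ∈ P ↔ pq.1 < pq.2 ∧ pq.2 ≤ n ∧ A pq.1 ≠ A pq.2 ∧ θlo < τ pq ∧ τ pq < θhi := by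
    intro pq
    rw [hP, mem_filter, mem_product, mem_range, mem_range]
    constructor
    · rintro ⟨⟨-, h2⟩, h3, h4, h5, h6⟩; exact ⟨h3, by omega, h4, h5, h6⟩
    · rintro ⟨h3, h2, h4, h5, h6⟩; exact ⟨⟨by omega, by omega⟩, h3, h4, h5, h6⟩
  have hmemEV : ∀ pq : ℕ × ℕ, pq ∈ EV ↔ (pq.1 < pq.2 ∧ pq.2 ≤ n ∧ A pq.1 ≠ A pq.2 ∧ θlo < τ pq ∧ τ pq < θhi) ∧
      (lab A B (pq.2 - 1) (τ pq) = pq.1 ∧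
        fold (altA (shift 0 (rev i n w₁))) (altB (shift 0 (rev i n w₀))) (n - pq.2) (τ pq) =
          L (altA (shift 0 (rev i n w₁))) (altB (shift 0 (rev i n w₀))) (n - pq.2) (τ pq)) := by
    intro pq
    rw [hEV, mem_filter, mem_product, mem_range, mem_range]
    constructor
    · rintro ⟨⟨-, h2⟩, h3, h4, h5, h6, h7⟩; exact ⟨⟨h3, by omega, h4, h5, h6⟩, h7⟩
    · rintro ⟨⟨h3, h2, h4, h5, h6⟩, h7⟩; exact ⟨⟨by omega, by omega⟩, h3, h4, h5, h6, h7⟩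
  have hEVP : ∀ pq, pq ∈ EV → pq ∈ P := fun pq hpq => (hmemP pq).mpr ((hmemEV pq).mp hpq).1
  -- `τ` is injective on `P` (general position)
  have hτinj : ∀ pq ∈ P, ∀ pq' ∈ P, τ pq = τ pq' → pq = pq' := by
    intro pq hpq pq' hpq' h
    obtain ⟨h1, h2, h3, -, -⟩ := (hmemP pq).mp hpq
    obtain ⟨h1', h2', h3', -, -⟩ := (hmemP pq').mp hpq'
    by_contra hne
    have hneq : pq.1 ≠ pq'.1 ∨ pq.2 ≠ pq'.2 := by
      by_contra hh; push Not at hh; exact hne (Prod.ext hh.1 hh.2)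
    exact hgen pq.1 pq.2 pq'.1 pq'.2 h1 h2 h1' h2' hneq h3 h3' h
  -- cuts: all crossing abscissae in the window, and the two ends
  set X : Finset ℝ := insert θlo (insert θhi (P.image τ)) with hX
  have hXP : ∀ pq ∈ P, τ pq ∈ X := fun pq hpq => by
    rw [hX]; exact mem_insert_of_mem (mem_insert_of_mem (mem_image_of_mem τ hpq))
  have hXhi : θhi ∈ X := by rw [hX]; exact mem_insert_of_mem (mem_insert_self _ _)
  -- next / previous cut (opaque functions with their defining equations)
  obtain ⟨nxt, hnxt⟩ : ∃ f : ℝ → ℝ, ∀ x, f x = (insert θhi (X.filter (fun y => x < y))).min' (insert_nonempty _ _) :=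
    ⟨_, fun _ => rfl⟩
  obtain ⟨prv, hprv⟩ : ∃ f : ℝ → ℝ, ∀ x, f x = (insert θlo (X.filter (fun y => y < x))).max' (insert_nonempty _ _) :=
    ⟨_, fun _ => rfl⟩
  have hnxt_gt : ∀ x, x < θhi → x < nxt x := by
    intro x hx
    rw [hnxt, lt_min'_iff]
    intro y hy
    rw [mem_insert, mem_filter] at hy
    rcases hy with rfl | ⟨-, h⟩
    · exact hx
    · exact h
  have hnxt_le : ∀ x, ∀ y ∈ X, x < y → nxt x ≤ y := by
    intro x y hy hxy; rw [hnxt]; exact min'_le _ _ (mem_insert_of_mem (mem_filter.mpr ⟨hy, hxy⟩))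
  have hnxt_hi : ∀ x, nxt x ≤ θhi := by intro x; rw [hnxt]; exact min'_le _ _ (mem_insert_self _ _)
  have hprv_lt : ∀ x, θlo < x → prv x < x := by
    intro x hx
    rw [hprv, max'_lt_iff]
    intro y hy
    rw [mem_insert, mem_filter] at hy
    rcases hy with rfl | ⟨-, h⟩
    · exact hx
    · exact h
  have hprv_ge : ∀ x, ∀ y ∈ X, y < x → y ≤ prv x := by
    intro x y hy hyx; rw [hprv]; exact le_max' _ _ (mem_insert_of_mem (mem_filter.mpr ⟨hy, hyx⟩))
  have hprv_lo : ∀ x, θlo ≤ prv x := by intro x; rw [hprv]; exact le_max' _ _ (mem_insert_self _ _)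
  -- the cut property around a crossing abscissa `τ pq₀`, `pq₀ ∈ P`: every OTHER non-parallel pair is outside `(prv, nxt)`
  have hcutP : ∀ pq₀ ∈ P, ∀ p q, p < q → q ≤ n → A p ≠ A q → (p ≠ pq₀.1 ∨ q ≠ pq₀.2) →
      τ (p, q) ≤ prv (τ pq₀) ∨ nxt (τ pq₀) ≤ τ (p, q) := by
    intro pq₀ hpq₀ p q hpq hqn hA hne
    by_cases hin : θlo < τ (p, q) ∧ τ (p, q) < θhi
    · have hPpq : (p, q) ∈ P := (hmemP (p, q)).mpr ⟨hpq, hqn, hA, hin.1, hin.2⟩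
      rcases lt_trichotomy (τ (p, q)) (τ pq₀) with h | h | h
      · exact Or.inl (hprv_ge _ _ (hXP _ hPpq) h)
      · exfalso
        have := hτinj _ hPpq _ hpq₀ h
        rw [← this] at hne
        simp at hne
      · exact Or.inr (hnxt_le _ _ (hXP _ hPpq) h)
    · rw [not_and_or] at hin
      rcases hin with h | h
      · exact Or.inl ((not_lt.mp h).trans (hprv_lo _))
      · exact Or.inr ((hnxt_hi _).trans (not_lt.mp h))
  -- the event abscissae
  set E : Finset ℝ := EV.image τ with hE
  have hEcard : E.card = EV.card := card_image_of_injOn (fun pq hpq pq' hpq' h => hτinj pq (hEVP pq hpq) pq' (hEVP pq' hpq') h)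
  -- degenerate case: no event crossing
  rcases Nat.eq_zero_or_pos EV.card with hN0 | hNpos
  · set t₀ := (θlo + nxt θlo) / 2 with ht₀
    have h1 : θlo < t₀ := by have := hnxt_gt θlo hlohi; rw [ht₀]; linarith
    have h2 : t₀ < nxt θlo := by have := hnxt_gt θlo hlohi; rw [ht₀]; linarith
    have hdis₀ := distinct_of_no_crossing_at w₁ w₀ (n := n) hpar (t := t₀) (by
      intro p q hpq hqn hA he
      by_cases hin : θlo < τ (p, q) ∧ τ (p, q) < θhi
      · have hPpq : (p, q) ∈ P := (hmemP (p, q)).mpr ⟨hpq, hqn, hA, hin.1, hin.2⟩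
        have := hnxt_le θlo _ (hXP _ hPpq) hin.1
        have he' : τ (p, q) = t₀ := he
        rw [he'] at this; linarith
      · rw [not_and_or] at hin
        have he' : τ (p, q) = t₀ := he
        rcases hin with h | h
        · exact h (by rw [he']; exact h1)
        · exact h (by rw [he']; exact lt_of_lt_of_le h2 (hnxt_hi _)))
    obtain ⟨M₀, hM₀, hM₀opt⟩ := exists_opt_eq w₁ w₀ i n t₀
    refine ⟨0, fun _ => t₀, fun _ => M₀, hN0.symm, ?_, fun _ => ⟨h1, lt_of_lt_of_le h2 (hnxt_hi _)⟩, fun _ => hM₀,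
      fun _ => hM₀opt.symm, fun _ => hdis₀, fun e => e.elim0⟩
    intro a b hab
    exact absurd (Fin.lt_def.mp hab) (by have := a.2; have := b.2; omega)
  -- general case: sort the event abscissae
  obtain ⟨e, he_mono, he_mem, he_surj⟩ :
      ∃ e : Fin EV.card → ℝ, StrictMono e ∧ (∀ j, e j ∈ E) ∧ (∀ x ∈ E, ∃ j, e j = x) := by
    refine ⟨fun j => E.orderEmbOfFin hEcard j, (E.orderEmbOfFin hEcard).strictMono, fun j => orderEmbOfFin_mem _ _ _,
      fun x hx => ?_⟩
    have hx' : x ∈ Set.range (E.orderEmbOfFin hEcard) := by rw [range_orderEmbOfFin]; exact hx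
    exact hx'
  have hpq : ∀ j, ∃ pq ∈ EV, τ pq = e j := fun j => by
    have := he_mem j; rw [hE, mem_image] at this; exact this
  choose pqOf hpqEV hpqτ using hpq
  have hpqP : ∀ j, pqOf j ∈ P := fun j => hEVP _ (hpqEV j)
  have he_lo : ∀ j, θlo < e j := fun j => by rw [← hpqτ j]; exact ((hmemP _).mp (hpqP j)).2.2.2.1
  have he_hi : ∀ j, e j < θhi := fun j => by rw [← hpqτ j]; exact ((hmemP _).mp (hpqP j)).2.2.2.2
  have he_X : ∀ j, e j ∈ X := fun j => by rw [← hpqτ j]; exact hXP _ (hpqP j)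
  -- samples: `U j` just before `e j`, `S j` just after
  obtain ⟨U, hU⟩ : ∃ f : Fin EV.card → ℝ, ∀ j, f j = (prv (e j) + e j) / 2 := ⟨_, fun _ => rfl⟩
  obtain ⟨S, hS⟩ : ∃ f : Fin EV.card → ℝ, ∀ j, f j = (e j + nxt (e j)) / 2 := ⟨_, fun _ => rfl⟩
  have hU1 : ∀ j, prv (e j) < U j := fun j => by have := hprv_lt (e j) (he_lo j); rw [hU]; linarith
  have hU2 : ∀ j, U j < e j := fun j => by have := hprv_lt (e j) (he_lo j); rw [hU]; linarith
  have hS1 : ∀ j, e j < S j := fun j => by have := hnxt_gt (e j) (he_hi j); rw [hS]; linarith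
  have hS2 : ∀ j, S j < nxt (e j) := fun j => by have := hnxt_gt (e j) (he_hi j); rw [hS]; linarith
  have hUlo : ∀ j, θlo < U j := fun j => lt_of_le_of_lt (hprv_lo _) (hU1 j)
  have hShi : ∀ j, S j < θhi := fun j => lt_of_lt_of_le (hS2 j) (hnxt_hi _)
  -- no crossing abscissa equals a sample; distinct values there
  have hnoτ : ∀ j (t : ℝ), prv (e j) < t → t < nxt (e j) → t ≠ e j →
      ∀ p q, p < q → q ≤ n → A p ≠ A q → τ (p, q) ≠ t := by
    intro j t ht1 ht2 hte p q hpq hqn hA he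
    by_cases hsame : p = (pqOf j).1 ∧ q = (pqOf j).2
    · apply hte
      rw [← he, ← hpqτ j, hsame.1, hsame.2]
    · have hne' : p ≠ (pqOf j).1 ∨ q ≠ (pqOf j).2 := by
        by_contra hh; push Not at hh; exact hsame hh
      rcases hcutP (pqOf j) (hpqP j) p q hpq hqn hA hne' with h | h
      · rw [hpqτ j] at h; linarith
      · rw [hpqτ j] at h; linarith
  have hdisU : ∀ j, ∀ p q, p ≤ n → q ≤ n → p ≠ q → L A B p (U j) ≠ L A B q (U j) := fun j =>
    distinct_of_no_crossing_at w₁ w₀ (n := n) hpar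
      (hnoτ j (U j) (hU1 j) ((hU2 j).trans ((hS1 j).trans (hS2 j))) (ne_of_lt (hU2 j)))
  have hdisS : ∀ j, ∀ p q, p ≤ n → q ≤ n → p ≠ q → L A B p (S j) ≠ L A B q (S j) := fun j =>
    distinct_of_no_crossing_at w₁ w₀ (n := n) hpar
      (hnoτ j (S j) ((hU1 j).trans ((hU2 j).trans (hS1 j))) (hS2 j) (ne_of_gt (hS1 j)))
  -- across each event the optimum changes
  have hchange : ∀ j, ∀ Mu Mv : Finset ℕ, Mu ∈ indepSets i n → Mv ∈ indepSets i n →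
      ∑ t ∈ Mu, W w₁ w₀ t (U j) = opt w₁ w₀ i n (U j) → ∑ t ∈ Mv, W w₁ w₀ t (S j) = opt w₁ w₀ i n (S j) → Mu ≠ Mv := by
    intro j Mu Mv hMu hMv hoptu hoptv
    obtain ⟨⟨hακ, hκn, hA, -, -⟩, hev⟩ := (hmemEV _).mp (hpqEV j)
    have hU' : U j = (prv (e j) + τ (pqOf j)) / 2 := by rw [hU, hpqτ]
    have hS' : S j = (τ (pqOf j) + nxt (e j)) / 2 := by rw [hS, hpqτ]
    rw [hU'] at hoptu
    rw [hS'] at hoptv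
    refine ne_across_eventCrossing w₁ w₀ hακ hκn hA (cm := prv (e j)) (cp := nxt (e j)) ?_ ?_ hpar ?_ hev hMu hMv hoptu hoptv
    · show prv (e j) < τ (pqOf j); rw [hpqτ j]; exact hprv_lt (e j) (he_lo j)
    · show τ (pqOf j) < nxt (e j); rw [hpqτ j]; exact hnxt_gt (e j) (he_hi j)
    · intro p q hpq hqn hApq hne'
      have h := hcutP (pqOf j) (hpqP j) p q hpq hqn hApq hne'
      rw [hpqτ j] at h
      exact h
  -- between `S j` and `U (j+1)` nothing changes
  have hlink : ∀ (j j' : Fin EV.card), (j' : ℕ) = j + 1 → S j ≤ U j' := by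
    intro j j' hjj'
    have hlt : e j < e j' := he_mono (Fin.lt_def.mpr (by omega))
    have h1 := hnxt_le (e j) (e j') (he_X j') hlt
    have h2 := hprv_ge (e j') (e j) (he_X j) hlt
    rw [hS, hU]; linarith
  have hstill : ∀ (j j' : Fin EV.card), (j' : ℕ) = j + 1 → ∀ Mv Mu : Finset ℕ, Mv ∈ indepSets i n → Mu ∈ indepSets i n →
      ∑ t ∈ Mv, W w₁ w₀ t (S j) = opt w₁ w₀ i n (S j) → ∑ t ∈ Mu, W w₁ w₀ t (U j') = opt w₁ w₀ i n (U j') → Mv = Mu := by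
    intro j j' hjj' Mv Mu hMv hMu hoptv hoptu
    rcases (hlink j j' hjj').lt_or_eq with hlt | heq
    · refine eq_of_no_eventCrossing w₁ w₀ hlt hgen (hdisS j) (hdisU j') ?_ hMv hMu hoptv hoptu
      intro p q hpq hqn hA h1 h2 hev
      -- an event crossing strictly between two consecutive event abscissae: impossible
      have hlo' : θlo < τ (p, q) := (hUlo j).trans ((hU2 j).trans ((hS1 j).trans h1))
      have hhi' : τ (p, q) < θhi := h2.trans ((hU2 j').trans (he_hi j'))
      have hmem : (p, q) ∈ EV := (hmemEV (p, q)).mpr ⟨⟨hpq, hqn, hA, hlo', hhi'⟩, hev⟩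
      obtain ⟨l, hl⟩ := he_surj (τ (p, q)) (by rw [hE]; exact mem_image_of_mem τ hmem)
      have h3 : e j < e l := by rw [hl]; exact (hS1 j).trans h1
      have h4 : e l < e j' := by rw [hl]; exact h2.trans (hU2 j')
      have h5 := he_mono.lt_iff_lt.mp h3
      have h6 := he_mono.lt_iff_lt.mp h4
      rw [Fin.lt_def] at h5 h6
      omega
    · rw [heq] at hoptv
      exact eq_of_opt_of_distinct w₁ w₀ i n (U j') (hdisU j') Mv Mu hMv hMu hoptv hoptu
  -- the chain
  have hN1 : 0 < EV.card := hNpos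
  set θs : Fin (EV.card + 1) → ℝ := fun k => if h : (k : ℕ) = 0 then U ⟨0, hN1⟩ else S ⟨(k : ℕ) - 1, by omega⟩ with hθs
  have hθsucc : ∀ j : Fin EV.card, θs j.succ = S j := by
    intro j
    rw [hθs]
    simp only [Fin.val_succ, Nat.add_one_ne_zero, dif_neg, not_false_eq_true, Nat.add_sub_cancel, Fin.eta]
  have hθzero : θs 0 = U ⟨0, hN1⟩ := by rw [hθs]; simp
  have hθcast : ∀ j : Fin EV.card, (j : ℕ) ≠ 0 → θs j.castSucc = S ⟨(j : ℕ) - 1, by omega⟩ := by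
    intro j hj
    rw [hθs]
    simp only [Fin.val_castSucc, hj, dif_neg, not_false_eq_true]
  have hex : ∀ k, ∃ M ∈ indepSets i n, opt w₁ w₀ i n (θs k) = ∑ t ∈ M, W w₁ w₀ t (θs k) :=
    fun k => exists_opt_eq w₁ w₀ i n (θs k)
  choose Ms hMs hMsopt using hex
  -- every sample is a `U` or an `S`
  have hsample : ∀ k : Fin (EV.card + 1), (∃ j, θs k = U j) ∨ (∃ j, θs k = S j) := by
    intro k
    by_cases hk : (k : ℕ) = 0
    · left; exact ⟨⟨0, hN1⟩, by rw [hθs]; simp [hk]⟩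
    · right; exact ⟨⟨(k : ℕ) - 1, by omega⟩, by rw [hθs]; simp [hk]⟩
  refine ⟨EV.card, θs, Ms, rfl, ?_, ?_, hMs, fun k => (hMsopt k).symm, ?_, ?_⟩
  · -- strictly increasing
    rw [Fin.strictMono_iff_lt_succ]
    intro j
    rw [hθsucc]
    by_cases hj : (j : ℕ) = 0
    · have : j = ⟨0, hN1⟩ := Fin.ext hj
      rw [show θs j.castSucc = U ⟨0, hN1⟩ by rw [hθs]; simp [hj], ← this]
      exact (hU2 j).trans (hS1 j)
    · rw [hθcast j hj]
      have hl := hlink ⟨(j : ℕ) - 1, by omega⟩ j (by simp; omega)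
      exact lt_of_le_of_lt hl ((hU2 j).trans (hS1 j))
  · -- inside the window
    intro k
    rcases hsample k with ⟨j, hj⟩ | ⟨j, hj⟩
    · rw [hj]; exact ⟨hUlo j, (hU2 j).trans (he_hi j)⟩
    · rw [hj]; exact ⟨(he_lo j).trans (hS1 j), hShi j⟩
  · -- distinct values at every sample
    intro k
    rcases hsample k with ⟨j, hj⟩ | ⟨j, hj⟩
    · rw [hj]; exact hdisU j
    · rw [hj]; exact hdisS j
  · -- consecutive optima differ
    intro j hEq
    have hopt1 := (hMsopt j.succ).symm
    rw [hθsucc] at hopt1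
    by_cases hj : (j : ℕ) = 0
    · have hopt0 := (hMsopt j.castSucc).symm
      have e0 : θs j.castSucc = U j := by
        rw [hθs]; simp only [Fin.val_castSucc, hj, dif_pos]; congr 1; exact Fin.ext hj.symm
      rw [e0] at hopt0
      exact hchange j _ _ (hMs _) (hMs _) hopt0 hopt1 hEq
    · have hopt0 := (hMsopt j.castSucc).symm
      rw [hθcast j hj] at hopt0
      obtain ⟨Mu, hMu, hMuopt⟩ := exists_opt_eq w₁ w₀ i n (U j)
      have h1 := hstill ⟨(j : ℕ) - 1, by omega⟩ j (by simp; omega) _ _ (hMs _) hMu hopt0 hMuopt.symm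
      have h2 := hchange j Mu _ hMu (hMs _) hMuopt.symm hopt1
      exact h2 (h1 ▸ hEq)

end

end StaticPathFold

end Summit.ValiantsHypothesis.ValiantsHypothesis.Theorems.KPlusLogSqLaw
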